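import Summits.Ventures.Crystal3D.Theorems.StickyWulffConstantGenericWallFloorLineCountOffset
import Summits.Ventures.Crystal3D.Theorems.StickyWulffConstantGenericWallFloorRunTops
import Summits.Ventures.Crystal3D.Theorems.StickyWulffConstantGenericWallFloorSlotSum
import Summits.Ventures.Crystal3D.Theorems.StickyWulffConstantGenericWallFloorAffineSampleDeficit
import Summits.Ventures.Crystal3D.Theorems.StickyWulffConstantCoaxialWallLawInPlaneFrames
import Summits.Ventures.Crystal3D.Theorems.StickyWulffConstantCoaxialWallLawInPlaneCount
import HarnessLib

/-!
# Run tops of one bond class inside a clamped slab sample: the per-class lower count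

HONEST FRAMING. Part of the venture `Summits/Ventures/Crystal3D` (cell `crystal3d-full`), helper for the
crux `GenericWallFloor` (stmt-Ventures-19480) of `route-Ventures-StickyWulffConstant`, line `WallLedgerG`:
the CREDIT COUNT of the rigid-bicrystal rung of `stub_twoSlabAdhesion` (slot ledger).  Pure lattice
geometry and counting; nothing about ground states; rung credit only.

* `exists_frame_of_mem_fccSlots` — every one of the twelve slots `w` of `Λ₀ = fccStacking 1 √(2/3)` is the
  third vector of a unimodular frame `(Ea, Eb, w)`: `‖Ea‖, ‖Eb‖ ≤ 1`, `det(Ea, Eb, w)² = ½`, the frame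
  generates exactly `Λ₀` over `ℤ` (the format consumed by `lineCount_offset_window`,
  `forced_runEnds_offset`, `forced_vacantSlots_cell`).
* `tops_ge_lineCount` — **Theorem.**  For the clamped slab sample
  `P = (A·Λ₀ + t) ∩ {a ≤ p₂ ≤ a + R, p₀² + p₁² ≤ ρ²}` (`1 ≤ R ≤ ρ`) of a moved fcc lattice and a slot
  `w ∈ fccSlots`, the number of RUN TOPS of class `w` inside `P`, `#{p ∈ P : p + A w ∉ P}`, is at least
  `√2 |⟪A w, e₃⟫| π ρ² − 10 √2 π ρ`: every bond line of class `w` meeting `P` carries exactly one top of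
  its (finite) run in `P`, and `lineCount_offset_window` counts the lines.

In the ledger these tops are (i) for the slots pointing OUT of the cell the outer-face credits (they are
empty in any configuration living in the cell) and (ii) for the steep slot `u*` the seeds of the inner
credits (pushed along the ray to the top of the run of the grain, `…RunTops`).

WHAT THIS IS NOT: nothing about the crux stub beyond this count; rung F-C1 not moved.
-/

noncomputable section

namespace Summit.Ventures.Crystal3D.Theorems

open Summit.Ventures.Crystal3D Finset Matrix
open Literature.MathematicalPhysics.StatisticalMechanics (barlowPos fccStacking constHagg haggLabel_const
  barlowPos_mem)
open scoped InnerProductSpace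

/-! ## Unimodular frames for the twelve slots -/

/-- A frame for `w` gives a frame for `−w` (flip the sign of the third coordinate): if `(Ea, Eb, w)` is a
unimodular `ℤ`-frame of `Λ₀` (`‖Ea‖, ‖Eb‖ ≤ 1`, `det² = ½`, integer combinations lie in `Λ₀` and exhaust
it) then so is `(Ea, Eb, −w)`. -/
theorem slotFrame_neg {w Ea Eb : EuclideanSpace ℝ (Fin 3)}
    (hdet : (Matrix.det ![WithLp.ofLp Ea, WithLp.ofLp Eb, WithLp.ofLp w]) ^ 2 = 1 / 2)
    (hframe : ∀ a b τ : ℤ, (a : ℝ) • Ea + (b : ℝ) • Eb + (τ : ℝ) • w ∈ fccStacking 1 (Real.sqrt (2 / 3)))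
    (hspan : ∀ q ∈ fccStacking 1 (Real.sqrt (2 / 3)), ∃ a b τ : ℤ,
      q = (a : ℝ) • Ea + (b : ℝ) • Eb + (τ : ℝ) • w) :
    (Matrix.det ![WithLp.ofLp Ea, WithLp.ofLp Eb, WithLp.ofLp (-w)]) ^ 2 = 1 / 2 ∧
    (∀ a b τ : ℤ, (a : ℝ) • Ea + (b : ℝ) • Eb + (τ : ℝ) • (-w) ∈ fccStacking 1 (Real.sqrt (2 / 3))) ∧
    (∀ q ∈ fccStacking 1 (Real.sqrt (2 / 3)), ∃ a b τ : ℤ,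
      q = (a : ℝ) • Ea + (b : ℝ) • Eb + (τ : ℝ) • (-w)) := by
  refine ⟨(det_sq_neg_third Ea Eb w).trans hdet, fun a b τ => ?_, fun q hq => ?_⟩
  · have := hframe a b (-τ)
    rw [Int.cast_neg, neg_smul] at this
    rwa [smul_neg]
  · obtain ⟨a, b, τ, rfl⟩ := hspan q hq
    refine ⟨a, b, -τ, ?_⟩
    rw [Int.cast_neg, neg_smul, smul_neg, neg_neg]

/-- **Every slot has a unimodular `ℤ`-frame**: for each of the twelve slots `w` of `Λ₀` there are
`Ea, Eb` with `‖Ea‖, ‖Eb‖ ≤ 1`, `det(Ea, Eb, w)² = ½`, all integer combinations `a•Ea + b•Eb + τ•w` in `Λ₀`,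
and every point of `Λ₀` of that form (the format consumed by `lineCount_offset_window` and
`forced_vacantSlots_cell`).  Six explicit frames (`…CoaxialWallLawInPlaneFrames` for `u, v, u − v`; here
`t, u − t, v − t`) and their sign flips. -/
theorem exists_frame_of_mem_fccSlots {w : EuclideanSpace ℝ (Fin 3)} (hw : w ∈ fccSlots) :
    ∃ Ea Eb : EuclideanSpace ℝ (Fin 3), ‖Ea‖ ≤ 1 ∧ ‖Eb‖ ≤ 1 ∧
      (Matrix.det ![WithLp.ofLp Ea, WithLp.ofLp Eb, WithLp.ofLp w]) ^ 2 = 1 / 2 ∧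
      (∀ a b τ : ℤ, (a : ℝ) • Ea + (b : ℝ) • Eb + (τ : ℝ) • w ∈ fccStacking 1 (Real.sqrt (2 / 3))) ∧
      (∀ q ∈ fccStacking 1 (Real.sqrt (2 / 3)), ∃ a b τ : ℤ,
        q = (a : ℝ) • Ea + (b : ℝ) • Eb + (τ : ℝ) • w) := by
  classical
  -- the property, abbreviated
  let F : EuclideanSpace ℝ (Fin 3) → Prop := fun w =>
    ∃ Ea Eb : EuclideanSpace ℝ (Fin 3), ‖Ea‖ ≤ 1 ∧ ‖Eb‖ ≤ 1 ∧
      (Matrix.det ![WithLp.ofLp Ea, WithLp.ofLp Eb, WithLp.ofLp w]) ^ 2 = 1 / 2 ∧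
      (∀ a b τ : ℤ, (a : ℝ) • Ea + (b : ℝ) • Eb + (τ : ℝ) • w ∈ fccStacking 1 (Real.sqrt (2 / 3))) ∧
      (∀ q ∈ fccStacking 1 (Real.sqrt (2 / 3)), ∃ a b τ : ℤ,
        q = (a : ℝ) • Ea + (b : ℝ) • Eb + (τ : ℝ) • w)
  change F w
  have hFneg : ∀ w, F w → F (-w) := by
    rintro w ⟨Ea, Eb, hEa, hEb, hdet, hframe, hspan⟩
    obtain ⟨h1, h2, h3⟩ := slotFrame_neg hdet hframe hspan
    exact ⟨Ea, Eb, hEa, hEb, h1, h2, h3⟩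
  have c_u : F (barlowPos 1 (Real.sqrt (2 / 3)) constHagg 0 1 0) := by
    obtain ⟨h1, h2, -, h4, h5, h6⟩ := inPlaneFrame_u
    exact ⟨_, _, h1, h2, h4, h5, h6⟩
  have c_v : F (barlowPos 1 (Real.sqrt (2 / 3)) constHagg 0 0 1) := by
    obtain ⟨h1, h2, -, h4, h5, h6⟩ := inPlaneFrame_v
    exact ⟨_, _, h1, h2, h4, h5, h6⟩
  have c_uv : F (barlowPos 1 (Real.sqrt (2 / 3)) constHagg 0 1 (-1)) := by
    obtain ⟨h1, h2, -, h4, h5, h6⟩ := inPlaneFrame_uv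
    exact ⟨_, _, h1, h2, h4, h5, h6⟩
  -- frame for `t = (1,0,0)`: `(u − t, u − v, t)`
  have c_t : F (barlowPos 1 (Real.sqrt (2 / 3)) constHagg 1 0 0) := by
    have hpt : ∀ a b τ : ℤ, barlowPos 1 (Real.sqrt (2 / 3)) constHagg (τ - a) (a + b) (-b) =
        (a : ℝ) • barlowPos 1 (Real.sqrt (2 / 3)) constHagg (-1) 1 0 +
          (b : ℝ) • barlowPos 1 (Real.sqrt (2 / 3)) constHagg 0 1 (-1) +
          (τ : ℝ) • barlowPos 1 (Real.sqrt (2 / 3)) constHagg 1 0 0 := by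
      intro a b τ
      rw [barlowPos_fcc_linear 1 _ (τ - a) (a + b) (-b), barlowPos_fcc_linear 1 _ (-1) 1 0,
        barlowPos_fcc_linear 1 _ 0 1 (-1)]
      push_cast; module
    refine ⟨barlowPos 1 (Real.sqrt (2 / 3)) constHagg (-1) 1 0,
      barlowPos 1 (Real.sqrt (2 / 3)) constHagg 0 1 (-1), (norm_barlowPos_fcc_eq_one (by norm_num)).le,
      (norm_barlowPos_fcc_eq_one (by norm_num)).le, det_sq_barlowPos_fcc (by norm_num), fun a b τ => ?_, ?_⟩
    · rw [← hpt]; exact barlowPos_mem _ _ _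
    · rintro q ⟨k, i, j, rfl⟩
      refine ⟨i + j, -j, k + i + j, ?_⟩
      have := hpt (i + j) (-j) (k + i + j)
      rw [show k + i + j - (i + j) = k by ring, show i + j + -j = i by ring, neg_neg] at this
      rw [← this]
  -- frame for `u − t = (−1,1,0)`: `(t, u − v, u − t)`
  have c_ut : F (barlowPos 1 (Real.sqrt (2 / 3)) constHagg (-1) 1 0) := by
    have hpt : ∀ a b τ : ℤ, barlowPos 1 (Real.sqrt (2 / 3)) constHagg (a - τ) (τ + b) (-b) =
        (a : ℝ) • barlowPos 1 (Real.sqrt (2 / 3)) constHagg 1 0 0 +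
          (b : ℝ) • barlowPos 1 (Real.sqrt (2 / 3)) constHagg 0 1 (-1) +
          (τ : ℝ) • barlowPos 1 (Real.sqrt (2 / 3)) constHagg (-1) 1 0 := by
      intro a b τ
      rw [barlowPos_fcc_linear 1 _ (a - τ) (τ + b) (-b), barlowPos_fcc_linear 1 _ (-1) 1 0,
        barlowPos_fcc_linear 1 _ 0 1 (-1)]
      push_cast; module
    refine ⟨barlowPos 1 (Real.sqrt (2 / 3)) constHagg 1 0 0,
      barlowPos 1 (Real.sqrt (2 / 3)) constHagg 0 1 (-1), (norm_barlowPos_fcc_eq_one (by norm_num)).le,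
      (norm_barlowPos_fcc_eq_one (by norm_num)).le, det_sq_barlowPos_fcc (by norm_num), fun a b τ => ?_, ?_⟩
    · rw [← hpt]; exact barlowPos_mem _ _ _
    · rintro q ⟨k, i, j, rfl⟩
      refine ⟨k + i + j, -j, i + j, ?_⟩
      have := hpt (k + i + j) (-j) (i + j)
      rw [show k + i + j - (i + j) = k by ring, show i + j + -j = i by ring, neg_neg] at this
      rw [← this]
  -- frame for `v − t = (−1,0,1)`: `(u, v, v − t)`
  have c_vt : F (barlowPos 1 (Real.sqrt (2 / 3)) constHagg (-1) 0 1) := by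
    have hpt : ∀ a b τ : ℤ, barlowPos 1 (Real.sqrt (2 / 3)) constHagg (-τ) a (b + τ) =
        (a : ℝ) • barlowPos 1 (Real.sqrt (2 / 3)) constHagg 0 1 0 +
          (b : ℝ) • barlowPos 1 (Real.sqrt (2 / 3)) constHagg 0 0 1 +
          (τ : ℝ) • barlowPos 1 (Real.sqrt (2 / 3)) constHagg (-1) 0 1 := by
      intro a b τ
      rw [barlowPos_fcc_linear 1 _ (-τ) a (b + τ), barlowPos_fcc_linear 1 _ (-1) 0 1]
      push_cast; module
    refine ⟨barlowPos 1 (Real.sqrt (2 / 3)) constHagg 0 1 0,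
      barlowPos 1 (Real.sqrt (2 / 3)) constHagg 0 0 1, (norm_barlowPos_fcc_eq_one (by norm_num)).le,
      (norm_barlowPos_fcc_eq_one (by norm_num)).le, det_sq_barlowPos_fcc (by norm_num), fun a b τ => ?_, ?_⟩
    · rw [← hpt]; exact barlowPos_mem _ _ _
    · rintro q ⟨k, i, j, rfl⟩
      refine ⟨i, j + k, -k, ?_⟩
      have := hpt i (j + k) (-k)
      rw [neg_neg, show j + k + -k = j by ring] at this
      rw [← this]
  have hneg : ∀ k i j : ℤ, barlowPos 1 (Real.sqrt (2 / 3)) constHagg (-k) (-i) (-j) =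
      -barlowPos 1 (Real.sqrt (2 / 3)) constHagg k i j := by
    intro k i j
    rw [barlowPos_fcc_linear 1 _ (-k) (-i) (-j), barlowPos_fcc_linear 1 _ k i j]; push_cast; module
  rw [fccSlots, mem_image] at hw
  obtain ⟨c, hc, rfl⟩ := hw
  simp only [fccSlotTriples, mem_insert, mem_singleton] at hc
  rcases hc with rfl | rfl | rfl | rfl | rfl | rfl | rfl | rfl | rfl | rfl | rfl | rfl
  · exact c_u
  · exact c_v
  · exact c_t
  · exact c_uv
  · exact c_ut
  · exact c_vt
  · have e := hneg 0 1 0; simp only [neg_zero] at e; rw [e]; exact hFneg _ c_u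
  · have e := hneg 0 0 1; simp only [neg_zero] at e; rw [e]; exact hFneg _ c_v
  · have e := hneg 1 0 0; simp only [neg_zero] at e; rw [e]; exact hFneg _ c_t
  · have e := hneg 0 1 (-1); simp only [neg_zero, neg_neg] at e; rw [e]; exact hFneg _ c_uv
  · have e := hneg (-1) 1 0; simp only [neg_zero, neg_neg] at e; rw [e]; exact hFneg _ c_ut
  · have e := hneg (-1) 0 1; simp only [neg_zero, neg_neg] at e; rw [e]; exact hFneg _ c_vt

/-! ## The per-class lower count of run tops inside a clamped sample -/

/-- **Run tops of one class inside the clamped slab sample.**  See the module docstring.  The frame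
data `(Ea, Eb, w)` is any unimodular `ℤ`-frame of `Λ₀` with third vector the slot `w`
(`exists_frame_of_mem_fccSlots`; only the membership half `hframe` is used). -/
theorem tops_ge_lineCount
    (A : EuclideanSpace ℝ (Fin 3) ≃ₗᵢ[ℝ] EuclideanSpace ℝ (Fin 3)) (t : EuclideanSpace ℝ (Fin 3))
    (a R ρ : ℝ) (hR : 1 ≤ R) (hρ : R ≤ ρ)
    (P : Finset (EuclideanSpace ℝ (Fin 3)))
    (hP : ∀ p, p ∈ P ↔ (p ∈ (fun q => A q + t) '' fccStacking 1 (Real.sqrt (2 / 3)) ∧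
      a ≤ p 2 ∧ p 2 ≤ a + R ∧ p 0 ^ 2 + p 1 ^ 2 ≤ ρ ^ 2))
    (Ea Eb w : EuclideanSpace ℝ (Fin 3)) (hEa : ‖Ea‖ ≤ 1) (hEb : ‖Eb‖ ≤ 1) (hw : ‖w‖ = 1)
    (hdet : (Matrix.det ![WithLp.ofLp Ea, WithLp.ofLp Eb, WithLp.ofLp w]) ^ 2 = 1 / 2)
    (hframe : ∀ a b τ : ℤ,
      (a : ℝ) • Ea + (b : ℝ) • Eb + (τ : ℝ) • w ∈ fccStacking 1 (Real.sqrt (2 / 3))) :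
    Real.sqrt 2 * |⟪A w, EuclideanSpace.single (2 : Fin 3) (1 : ℝ)⟫_ℝ| * Real.pi * ρ ^ 2 -
        10 * Real.sqrt 2 * Real.pi * ρ ≤
      ((P.filter fun p => p + A w ∉ P).card : ℝ) := by
  classical
  -- pulled-back normal and offset
  set e₃ : EuclideanSpace ℝ (Fin 3) := EuclideanSpace.single (2 : Fin 3) (1 : ℝ) with he₃
  set ν : EuclideanSpace ℝ (Fin 3) := A.symm e₃ with hν
  set s : EuclideanSpace ℝ (Fin 3) := A.symm t with hs
  have he₃n : ‖e₃‖ = 1 := by rw [he₃, PiLp.norm_single, norm_one]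
  have hνn : ‖ν‖ = 1 := by rw [hν, LinearIsometryEquiv.norm_map, he₃n]
  have hAν : A ν = e₃ := by rw [hν, LinearIsometryEquiv.apply_symm_apply]
  have hAs : A s = t := by rw [hs, LinearIsometryEquiv.apply_symm_apply]
  have hαw : ⟪A w, e₃⟫_ℝ = ⟪w, ν⟫_ℝ := by rw [← hAν, LinearIsometryEquiv.inner_map_map]
  rw [hαw]
  -- the motion
  let g : EuclideanSpace ℝ (Fin 3) → EuclideanSpace ℝ (Fin 3) := fun q => A q + t
  have hgq : ∀ q, g q = A (q + s) := by intro q; simp only [g, map_add, hAs]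
  have h2 : ∀ q, g q 2 = ⟪q + s, ν⟫_ℝ := by
    intro q
    have : g q 2 = ⟪g q, e₃⟫_ℝ := by rw [he₃, EuclideanSpace.inner_single_right]; simp
    rw [this, hgq, ← hAν, LinearIsometryEquiv.inner_map_map]
  have hlat : ∀ q, g q 0 ^ 2 + g q 1 ^ 2 = ‖q + s‖ ^ 2 - ⟪q + s, ν⟫_ℝ ^ 2 := by
    intro q
    rw [sq_add_sq_eq_norm_sq_sub, ← he₃, hgq, LinearIsometryEquiv.norm_map, ← hAν,
      LinearIsometryEquiv.inner_map_map]
  have hgadd : ∀ q (m : ℕ), g q + ((m : ℕ) : ℝ) • A w = g (q + ((m : ℕ) : ℝ) • w) := by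
    intro q m; simp only [g, map_add, LinearIsometryEquiv.map_smul]; abel
  have hginj : Function.Injective g := by
    intro q q' hqq'
    have : A q = A q' := add_right_cancel hqq'
    exact A.injective this
  -- the frame has nonzero determinant: unique coordinates
  have hdet0 : Matrix.det ![WithLp.ofLp Ea, WithLp.ofLp Eb, WithLp.ofLp w] ≠ 0 := by
    intro h0; rw [h0] at hdet; norm_num at hdet
  -- a coordinate function `(a, b)` on frame points
  have hcoord : ∀ q : EuclideanSpace ℝ (Fin 3), ∃ ab : ℤ × ℤ, ∀ a b τ : ℤ,
      q = (a : ℝ) • Ea + (b : ℝ) • Eb + (τ : ℝ) • w → ab = (a, b) := by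
    intro q
    by_cases hq : ∃ a b τ : ℤ, q = (a : ℝ) • Ea + (b : ℝ) • Eb + (τ : ℝ) • w
    · obtain ⟨a, b, τ, hq⟩ := hq
      refine ⟨(a, b), fun a' b' τ' hq' => ?_⟩
      have huniq := frame_coords_unique Ea Eb w hdet0 a b τ a' b' τ' (by rw [← hq, ← hq'])
      obtain ⟨ha, hb, -⟩ := huniq
      exact Prod.ext (by exact_mod_cast ha) (by exact_mod_cast hb)
    · exact ⟨0, fun a b τ h => (hq ⟨a, b, τ, h⟩).elim⟩
  choose cf hcf using hcoord
  -- T := coordinates of the pulled-back tops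
  set Tops : Finset (EuclideanSpace ℝ (Fin 3)) := P.filter fun p => p + A w ∉ P with hTops
  set T : Finset (ℤ × ℤ) := Tops.image fun p => cf (A.symm (p - t)) with hT
  have hcardT : (T.card : ℝ) ≤ (Tops.card : ℝ) := by
    exact_mod_cast Finset.card_image_le
  have hw0 : A w ≠ 0 := by
    intro h0
    have : ‖A w‖ = 0 := by rw [h0, norm_zero]
    rw [LinearIsometryEquiv.norm_map, hw] at this
    norm_num at this
  -- every line meeting the sample contributes an element of `T`
  have key := lineCount_offset_window ν hνn R ρ a hR hρ Ea Eb w s hEa hEb hw hdet T ?_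
  · exact key.trans hcardT
  · intro a' b' τ h1 h2' h3
    -- the lattice point on this line inside the sample
    set y : EuclideanSpace ℝ (Fin 3) := (a' : ℝ) • Ea + (b' : ℝ) • Eb + (τ : ℝ) • w with hy
    have hyΛ : y ∈ fccStacking 1 (Real.sqrt (2 / 3)) := hframe a' b' τ
    have hpy : g y ∈ P := by
      rw [hP]
      refine ⟨⟨y, hyΛ, rfl⟩, ?_, ?_, ?_⟩
      · rw [h2]; exact h1
      · rw [h2]; exact h2'
      · rw [hlat]; exact h3
    -- the top of its run in `P`
    obtain ⟨m, hmP, hmnot, -⟩ := exists_runTop P (g y) (A w) hw0 hpy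
    have htop : g y + ((m : ℕ) : ℝ) • A w ∈ Tops := by
      rw [hTops, mem_filter]
      refine ⟨hmP, ?_⟩
      have : g y + ((m : ℕ) : ℝ) • A w + A w = g y + ((m + 1 : ℕ) : ℝ) • A w := by
        push_cast; rw [add_smul, one_smul, add_assoc]
      rw [this]; exact hmnot
    rw [hT, mem_image]
    refine ⟨g y + ((m : ℕ) : ℝ) • A w, htop, ?_⟩
    have hpull : A.symm (g y + ((m : ℕ) : ℝ) • A w - t) = y + ((m : ℕ) : ℝ) • w := by
      rw [hgadd]
      simp only [g, add_sub_cancel_right, LinearIsometryEquiv.symm_apply_apply]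
    rw [hpull]
    refine hcf _ a' b' (τ + m) ?_
    rw [hy]; push_cast; module

end Summit.Ventures.Crystal3D.Theorems

end
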